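import Literature.MathematicalPhysics.QuantumFieldTheory.O2ChargeFourRules
import Literature.MathematicalPhysics.QuantumFieldTheory.O2ChargedSectorsTermwise

/-!
# O(2) scan, charged `1 × 1` sectors `3` and `2⁻`: the finite-certificate rules

`O2ChargedSectorsTermwise` reduces `Pos3` / `Pos2m` of a scan functional at a regular `(Δ, ℓ)` to termwise
nonnegativity of ONE two-weight evaluation of the monomials `𝒫_{E,j}` — the dominated terms
`dom3Term F D E j = T(c₃, d₃; Δ_t)[𝒫_{E,j}]`, `dom2mTerm F D E j = T(c₂, d₂; Δ_t)[𝒫_{E,j}]` — weighted by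
the non-negative coefficients `A_{n,j}(d/2, d/2)/λ_ℓ`.  This file supplies the reader's rules, written
ONCE for an arbitrary two-weight term `T(c, d; s)[𝒫_{E,j}]` (§1) and then specialised (§2–§3):

* §1 generic rules for `twTerm F c d s E j := T(c, d; s)[𝒫_{E,j}]`: rule (M) on a box from one corner
  number (`twTerm_nonneg_on_box`), rule (T) from one apex number (`twTerm_nonneg_of_apex`), the
  descendant-range dispatch of the heavy range (`descendantTerms_nonneg_of_ranges`), cell tails
  (`cellTail_of_ranges`), and the head inequalities from the AB interval tables
  (`headSumAB_nonneg_of_cellSumI`, cell strictly above the bound) and from the AB bound tables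
  (`headSumAB_nonneg_of_cellSumBd`, `ℓ ≥ 1`, cell from `a ≥ ℓ + 1`);
* §2 sector `3`: `pos3_heavy` (item `tail_3`: every spin, every point `Δ ≥ E₀ > 1` above the bound),
  `pos3_on_cell_Ico[_of_corners]` (cells strictly above the bound; `ℓ = 0` cells avoid `Δ = 1`),
  `pos3_on_boundCell_Ico_of_corners` (`ℓ ≥ 1`, `a ≥ ℓ + 1`: the `spinning_3` rows from the bound);
* §3 sector `2⁻`: `pos2m_heavy` (item `tail_2m`), `pos2m_on_cell_Ico[_of_corners]`,
  `pos2m_on_boundCell_Ico_of_corners`.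

R-07.5 PLANNING for the O(2) client path; no numerics.  HONEST SCOPE: sufficient conditions only
(Cauchy–Schwarz domination, see `O2ChargedSectorsTermwise`); `(Δ, ℓ) = (1, 0)` of sector `3` is
certified by no rule here; the `2 × 2` sectors `1`, `2⁺` are not treated.  DECLARATIONS: one definition
(`twTerm`).

References: Chester–Landry–Liu–Poland–Simmons-Duffin–Su–Vichi, JHEP 06 (2020) 142, §3.1
(`ChesterEtAl2020`); Kos–Poland–Simmons-Duffin, JHEP 11 (2014) 109, §3.3 eq. (3.16), §4 eqs. (4.2)–(4.3)
(`KosPolandSimmonsduffin2014`); Pappadopulo–Rychkov–Espin–Rattazzi, Phys. Rev. D 86 (2012) 105043, §5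
(`PappadopuloRychkovEspinRattazzi2012`); Dolan–Osborn, Nucl. Phys. B 678 (2004) 491, §3 eqs.
(3.10)–(3.12) (`DolanOsborn2004`); Hogervorst–Rychkov, Phys. Rev. D 87 (2013) 106004, §3 eq. (3.6)
(`HogervorstRychkov2013`).
-/

namespace Literature.MathematicalPhysics.QuantumFieldTheory.O2ChargedSectorsRules

open Finset Set Filter Topology
open Literature.MathematicalPhysics.QuantumFieldTheory.O2ThreeScalarCrossing
open Literature.MathematicalPhysics.QuantumFieldTheory.O2ThreeScalarSystem
open Literature.MathematicalPhysics.QuantumFieldTheory.O2OPEScanBridge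
open Literature.MathematicalPhysics.QuantumFieldTheory.O2ScanObligations
open Literature.MathematicalPhysics.QuantumFieldTheory.O2NeutralSectorsTermwise
open Literature.MathematicalPhysics.QuantumFieldTheory.O2NeutralSectorsTail
open Literature.MathematicalPhysics.QuantumFieldTheory.O2ChargedSectorsTermwise
open ConformalBootstrap3D (IsConformalBlock3D IsRegularPoint3D unitarityBound3D accidentalDegeneracy3D
  crossF zMono zMono_nonneg legendreLam legendreLam_pos InDescendantRange hrCoeffAB twoWeightEval
  cornerBound₂ cornerBound₂_le hrCoeffABLo hrCoeffABHi hrCoeffAB_self_mem_Icc_interval oddHeadCellSumI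
  hrCoeffABBdLo hrCoeffABBdHi sub_mul_hrCoeffAB_self_sandwich oddHeadCellSumBd min_mul_le_mul_of_bounds
  unitarityBound3D_of_one_le unitarityBound3D_le_add_one eventually_isRegularPoint3D_nhdsGT_of_bound_le
  natCast_add_le_of_unitarityBound3D_lt natCast_add_half_le_unitarityBound3D)

/-! ### §1 Generic rules for a two-weight term -/

/-- The two-weight term `T(c, d; s)[𝒫_{E,j}]` of a scan functional's nodes.
[cite: HogervorstRychkov2013, §3 eq. (3.6)] -/
noncomputable def twTerm (F : ScanFunctional) (c d : Fin F.M → ℝ) (s E : ℝ) (j : ℕ) : ℝ :=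
  twoWeightEval c d F.z F.zb s (zMono E j)

/-- `dom3Term` is the two-weight term of `(c₃, d₃; Δ_t)`. Bookkeeping. [cite: PappadopuloRychkovEspinRattazzi2012, §5] -/
theorem dom3Term_eq_twTerm (F : ScanFunctional) (D : Dims) (E : ℝ) (j : ℕ) :
    dom3Term F D E j = twTerm F (cWeight3 F) (dWeight3 F) (D.expo .φttφ) E j := rfl

/-- `dom2mTerm` is the two-weight term of `(c₂, d₂; Δ_t)`. Bookkeeping. [cite: PappadopuloRychkovEspinRattazzi2012, §5] -/
theorem dom2mTerm_eq_twTerm (F : ScanFunctional) (D : Dims) (E : ℝ) (j : ℕ) :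
    dom2mTerm F D E j = twTerm F (cWeight2m F) (dWeight2m F) (D.expo .stts) E j := rfl

/-- **Rule (M)** for a two-weight term: `cornerBound₂ c d j E₁ E₂ s s ≥ 0 ⇒ T(c,d;s)[𝒫_{E,j}] ≥ 0` on
`E ∈ [E₁, E₂]`. [cite: HogervorstRychkov2013, §3 eq. (3.6)] -/
theorem twTerm_nonneg_on_box (F : ScanFunctional) (c d : Fin F.M → ℝ) (s : ℝ) (j : ℕ) {E₁ E₂ : ℝ}
    (h : 0 ≤ cornerBound₂ c d F.z F.zb j E₁ E₂ s s) :
    ∀ E ∈ Icc E₁ E₂, 0 ≤ twTerm F c d s E j := fun _ hE =>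
  h.trans (cornerBound₂_le c d F.z F.zb F.hz F.hzb j hE ⟨le_rfl, le_rfl⟩)

/-- **Rule (T)** for a two-weight term: in the dominated node configuration with apex `a`,
`c(a) v_a^{s} − apexRadTW(c, d; s, E_T) ≥ 0 ⇒ T(c,d;s)[𝒫_{E,j}] ≥ 0` for `E ≥ E_T`, `j ≤ E`.
[cite: HogervorstRychkov2013, §3 eq. (3.6)] -/
theorem twTerm_nonneg_of_apex (F : ScanFunctional) (c d : Fin F.M → ℝ) (s : ℝ)
    (hord : ∀ m, F.zb m ≤ F.z m) (a : Fin F.M) (qd qr : Fin F.M → ℝ) (hqd : ∀ m, 0 < qd m ∧ qd m ≤ 1)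
    (hqr : ∀ m, 0 < qr m ∧ qr m ≤ 1)
    (hdomd : ∀ m, F.z m * F.zb m ≤ qd m ^ 2 * (F.z a * F.zb a) ∧ F.z m ≤ qd m * F.z a)
    (hdomr : ∀ m, (1 - F.z m) * (1 - F.zb m) ≤ qr m ^ 2 * (F.z a * F.zb a) ∧ 1 - F.zb m ≤ qr m * F.z a)
    {ET : ℝ} (hapex : 0 ≤ c a * ((1 - F.z a) * (1 - F.zb a)) ^ s - apexRadTW F c d a qd qr s ET) :
    ∀ E : ℝ, ET ≤ E → ∀ j : ℕ, (j : ℝ) ≤ E → 0 ≤ twTerm F c d s E j := by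
  intro E hE j hjE
  have hP : 0 ≤ zMono E j (F.z a) (F.zb a) := zMono_nonneg E j (F.hz a).1.le (F.hzb a).1.le
  have h := abs_twoWeightEval_sub_apex_le F hord a qd qr (fun m => (hqd m).1) (fun m => (hqr m).1)
    hdomd hdomr hjE c d s
  rw [abs_le] at h
  have hanti := apexRadTW_anti_level F c d a hqd hqr s hE
  unfold twTerm
  nlinarith [h.1, mul_le_mul_of_nonneg_left hanti hP, mul_nonneg hP hapex]

/-- **Heavy-range dispatch**: rule (M) on `[E₀, E_T)` in the twist-gap domain (`j + τ ≤ E`, `τ ≤ 1`,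
`τ ≤ E₀`) and rule (T) on `[E_T, ∞)` give every descendant term `(Δ + n, j)` at a point `Δ ≥ E₀` above the
unitarity bound, for any term function `T`. Bookkeeping. [cite: KosPolandSimmonsduffin2014, §3.3 eq. (3.16)] -/
theorem descendantTerms_nonneg_of_ranges (T : ℝ → ℕ → ℝ) {E₀ ET τ : ℝ} (hτ1 : τ ≤ 1) (hτ0 : τ ≤ E₀)
    (hM : ∀ (j : ℕ) (E : ℝ), E₀ ≤ E → E < ET → (j : ℝ) + τ ≤ E → 0 ≤ T E j)
    (hT : ∀ E : ℝ, ET ≤ E → ∀ j : ℕ, (j : ℝ) ≤ E → 0 ≤ T E j)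
    {Δ : ℝ} {ℓ : ℕ} (hΔ : unitarityBound3D ℓ < Δ) (hΔ0 : E₀ ≤ Δ) :
    ∀ q : ℕ × ℕ, InDescendantRange ℓ q.1 q.2 → 0 ≤ T (Δ + (q.1 : ℝ)) q.2 := by
  intro q hq
  have hℓτ : (ℓ : ℝ) + τ ≤ Δ := natCast_add_le_of_unitarityBound3D_lt hτ1 hτ0 hΔ hΔ0
  have h1 : (q.2 : ℝ) ≤ (ℓ : ℝ) + (q.1 : ℝ) := by exact_mod_cast hq.2.1
  have hjE : (q.2 : ℝ) + τ ≤ Δ + (q.1 : ℝ) := by linarith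
  have hjE' : (q.2 : ℝ) ≤ Δ + (q.1 : ℝ) := by linarith [natCast_add_half_le_unitarityBound3D ℓ]
  have hE0 : E₀ ≤ Δ + (q.1 : ℝ) := hΔ0.trans (le_add_of_nonneg_right (Nat.cast_nonneg _))
  by_cases hlt : Δ + (q.1 : ℝ) < ET
  · exact hM q.2 (Δ + (q.1 : ℝ)) hE0 hlt hjE
  · exact hT (Δ + (q.1 : ℝ)) (not_lt.1 hlt) q.2 hjE'

/-- **Cell tails from (M)/(T)** for any term function: on a cell `[a, b]` with `a ≥ ℓ + τ`, head set `S`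
containing all descendant pairs of level `< N₀`, `a + N₀ ≥ E₀`. Bookkeeping. [cite: KosPolandSimmonsduffin2014, §3.3 eq. (3.16)] -/
theorem cellTail_of_ranges (T : ℝ → ℕ → ℝ) {ℓ : ℕ} {a b E₀ ET τ : ℝ} (hτ : (ℓ : ℝ) + τ ≤ a)
    (hτ0 : 0 ≤ τ) (N₀ : ℕ) (hN : E₀ ≤ a + N₀) (S : Finset (ℕ × ℕ))
    (hS : ∀ q : ℕ × ℕ, InDescendantRange ℓ q.1 q.2 → q.1 < N₀ → q ∈ S)
    (hM : ∀ (j : ℕ) (E : ℝ), E₀ ≤ E → E < ET → (j : ℝ) + τ ≤ E → 0 ≤ T E j)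
    (hT : ∀ E : ℝ, ET ≤ E → ∀ j : ℕ, (j : ℝ) ≤ E → 0 ≤ T E j) :
    ∀ q : ℕ × ℕ, q ∉ S → InDescendantRange ℓ q.1 q.2 → ∀ E ∈ Icc (a + q.1) (b + q.1), 0 ≤ T E q.2 := by
  intro q hq hr E hE
  have hn : (N₀ : ℝ) ≤ (q.1 : ℝ) := by
    have : ¬ q.1 < N₀ := fun h => hq (hS q hr h)
    exact_mod_cast not_lt.1 this
  have hE0 : E₀ ≤ E := by linarith [hE.1]
  have h1 : (q.2 : ℝ) ≤ (ℓ : ℝ) + (q.1 : ℝ) := by exact_mod_cast hr.2.1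
  have hjE : (q.2 : ℝ) + τ ≤ E := by linarith [hE.1]
  have hjE' : (q.2 : ℝ) ≤ E := by linarith
  by_cases hlt : E < ET
  · exact hM q.2 E hE0 hlt hjE
  · exact hT E (not_lt.1 hlt) q.2 hjE'

/-- **Head inequality from the AB interval tables** (cell `[a, b]` strictly above the bound, `c ∈ [c₁, c₂]`):
`oddHeadCellSumI ℓ c₁ c₂ a b S Φlo ≥ 0` with `Φlo_q ≤ T(Δ+n, j)` gives
`Σ_{q∈S} (A_q(c,c)/λ_ℓ) T(Δ+n, j) ≥ 0` at every `Δ ∈ [a, b]`. [cite: DolanOsborn2004, §3 eq. (3.12)] -/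
theorem headSumAB_nonneg_of_cellSumI (T : ℝ → ℕ → ℝ) {ℓ : ℕ} {a b c₁ c c₂ Δ : ℝ}
    (ha : unitarityBound3D ℓ < a) (hΔ : Δ ∈ Icc a b) (hc1 : c₁ ≤ c) (hc2 : c ≤ c₂)
    (S : Finset (ℕ × ℕ)) (Φlo : ℕ × ℕ → ℝ) (hΦ : ∀ q ∈ S, Φlo q ≤ T (Δ + (q.1 : ℝ)) q.2)
    (hX : 0 ≤ oddHeadCellSumI ℓ c₁ c₂ a b S Φlo) :
    0 ≤ ∑ q ∈ S, hrCoeffAB c c Δ ℓ q.1 q.2 / legendreLam ℓ * T (Δ + (q.1 : ℝ)) q.2 := by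
  have hlam : 0 < legendreLam ℓ := legendreLam_pos ℓ
  have hsum : oddHeadCellSumI ℓ c₁ c₂ a b S Φlo ≤ ∑ q ∈ S, hrCoeffAB c c Δ ℓ q.1 q.2 * T (Δ + (q.1 : ℝ)) q.2 := by
    refine Finset.sum_le_sum fun q hq => ?_
    have hA := hrCoeffAB_self_mem_Icc_interval ha hΔ.1 hΔ.2 hc1 hc2 q.1 q.2
    exact min_mul_le_mul_of_bounds hA.2.1 hA.2.2 (hA.1.trans hA.2.1) (hΦ q hq)
  have heq : ∑ q ∈ S, hrCoeffAB c c Δ ℓ q.1 q.2 / legendreLam ℓ * T (Δ + (q.1 : ℝ)) q.2 =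
      (legendreLam ℓ)⁻¹ * ∑ q ∈ S, hrCoeffAB c c Δ ℓ q.1 q.2 * T (Δ + (q.1 : ℝ)) q.2 := by
    rw [Finset.mul_sum]
    exact Finset.sum_congr rfl fun q _ => by rw [div_eq_inv_mul]; ring
  rw [heq]
  exact mul_nonneg (inv_nonneg.mpr hlam.le) (hX.trans hsum)

/-- **Head inequality from the AB bound tables** (`ℓ ≥ 1`, cell `[a, b]` with `a ≥ ℓ + 1`, at a point
`Δ > ℓ + 1` of the cell): `oddHeadCellSumBd ≥ 0` certifies `(Δ − ℓ − 1) · Σ_{q∈S} A_q T_q ≥ 0` and the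
positive factor is divided out. [cite: DolanOsborn2004, §3 eq. (3.11)] -/
theorem headSumAB_nonneg_of_cellSumBd (T : ℝ → ℕ → ℝ) {ℓ : ℕ} {a b c₁ c c₂ Δ : ℝ} (hℓ : 1 ≤ ℓ)
    (ha : (ℓ : ℝ) + 1 ≤ a) (hΔ : Δ ∈ Icc a b) (hx : (ℓ : ℝ) + 1 < Δ) (hc1 : c₁ ≤ c) (hc2 : c ≤ c₂)
    (S : Finset (ℕ × ℕ)) (Φlo : ℕ × ℕ → ℝ) (hΦ : ∀ q ∈ S, Φlo q ≤ T (Δ + (q.1 : ℝ)) q.2)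
    (hX : 0 ≤ oddHeadCellSumBd ℓ c₁ c₂ a b S Φlo) :
    0 ≤ ∑ q ∈ S, hrCoeffAB c c Δ ℓ q.1 q.2 / legendreLam ℓ * T (Δ + (q.1 : ℝ)) q.2 := by
  have hκ : 0 < Δ - ℓ - 1 := by linarith
  have hlam : 0 < legendreLam ℓ := legendreLam_pos ℓ
  have hterm : ∀ q ∈ S,
      min (hrCoeffABBdLo c₁ c₂ a b ℓ q.1 q.2 * Φlo q) (hrCoeffABBdHi c₁ c₂ a b ℓ q.1 q.2 * Φlo q) ≤
        ((Δ - ℓ - 1) * legendreLam ℓ) *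
          (hrCoeffAB c c Δ ℓ q.1 q.2 / legendreLam ℓ * T (Δ + (q.1 : ℝ)) q.2) := by
    intro q hq
    obtain ⟨hA0, hAl, hAh⟩ := sub_mul_hrCoeffAB_self_sandwich hℓ ha hΔ.1 hΔ.2 hx hc1 hc2 q.1 q.2
    have hmin := min_mul_le_mul_of_bounds hAl hAh (hA0.trans hAl) (hΦ q hq)
    have hrw : ((Δ - ℓ - 1) * legendreLam ℓ) *
        (hrCoeffAB c c Δ ℓ q.1 q.2 / legendreLam ℓ * T (Δ + (q.1 : ℝ)) q.2) =
        ((Δ - ℓ - 1) * hrCoeffAB c c Δ ℓ q.1 q.2) * T (Δ + (q.1 : ℝ)) q.2 := by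
      field_simp
    rw [hrw]
    exact hmin
  have hsum : 0 ≤ ((Δ - ℓ - 1) * legendreLam ℓ) *
      ∑ q ∈ S, hrCoeffAB c c Δ ℓ q.1 q.2 / legendreLam ℓ * T (Δ + (q.1 : ℝ)) q.2 := by
    rw [Finset.mul_sum]
    calc (0 : ℝ) ≤ oddHeadCellSumBd ℓ c₁ c₂ a b S Φlo := hX
      _ = ∑ q ∈ S, min (hrCoeffABBdLo c₁ c₂ a b ℓ q.1 q.2 * Φlo q)
            (hrCoeffABBdHi c₁ c₂ a b ℓ q.1 q.2 * Φlo q) := rfl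
      _ ≤ _ := Finset.sum_le_sum hterm
  exact (mul_nonneg_iff_of_pos_left (mul_pos hκ hlam)).mp hsum

/-! ### §2 Sector `3` -/

/-- **Heavy range, sector `3`, regular point** (`E₀ > 1`, so `Δ ≠ 1`).
[cite: PappadopuloRychkovEspinRattazzi2012, §5] [cite: KosPolandSimmonsduffin2014, §3.3 eq. (3.16)] -/
theorem sector3Value_nonneg_heavy (F : ScanFunctional) (D : Dims) {E₀ ET τ : ℝ} (hτ1 : τ ≤ 1)
    (hτ0 : τ ≤ E₀) (hE1 : 1 < E₀)
    (hM : ∀ (j : ℕ) (E : ℝ), E₀ ≤ E → E < ET → (j : ℝ) + τ ≤ E → 0 ≤ dom3Term F D E j)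
    (hT : ∀ E : ℝ, ET ≤ E → ∀ j : ℕ, (j : ℝ) ≤ E → 0 ≤ dom3Term F D E j)
    {Δ : ℝ} {ℓ : ℕ} (hΔ : unitarityBound3D ℓ < Δ) (hreg : ¬ accidentalDegeneracy3D Δ ℓ) (hΔ0 : E₀ ≤ Δ)
    {G : Label → ℝ → ℝ → ℝ} (hG₁ : IsConformalBlock3D (D.Δt - D.Δφ) (D.Δt - D.Δφ) Δ ℓ (G .tφtφ))
    (hG₂ : IsConformalBlock3D (-(D.Δt - D.Δφ)) (D.Δt - D.Δφ) Δ ℓ (G .φttφ)) :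
    0 ≤ sector3Value F D ((-1) ^ ℓ) G := by
  have h1 : ℓ = 0 → Δ ≠ 1 := fun _ => ne_of_gt (by linarith)
  exact (dom3Eval_nonneg_of_termwise F D hΔ hreg ∅ (by simp)
      (fun q _ hq => descendantTerms_nonneg_of_ranges (dom3Term F D) hτ1 hτ0 hM hT hΔ hΔ0 q hq) hG₂).trans
    (dom3Eval_le_sector3Value F D (abs_neg_one_pow_le_one ℓ) hΔ hreg h1 hG₁ hG₂)

/-- **Heavy range, sector `3`, all points** (the item `tail_3` of `O2Obligations`: every spin, every
`Δ ≥ E₀` above the unitarity bound; `E₀ > 1`). [cite: KosPolandSimmonsduffin2014, §3.3 eq. (3.16), §4 eqs. (4.2)–(4.3)]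
[cite: ChesterEtAl2020, §3.1 (functional conditions)] -/
theorem pos3_heavy (F : ScanFunctional) (D : Dims) {E₀ ET τ : ℝ} (hτ1 : τ ≤ 1) (hτ0 : τ ≤ E₀)
    (hE1 : 1 < E₀)
    (hM : ∀ (j : ℕ) (E : ℝ), E₀ ≤ E → E < ET → (j : ℝ) + τ ≤ E → 0 ≤ dom3Term F D E j)
    (hT : ∀ E : ℝ, ET ≤ E → ∀ j : ℕ, (j : ℝ) ≤ E → 0 ≤ dom3Term F D E j) :
    ∀ ℓ : ℕ, ∀ Δ : ℝ, unitarityBound3D ℓ ≤ Δ → E₀ ≤ Δ → Pos3 F.toFunctional D Δ ℓ := by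
  intro ℓ Δ hbd hΔ0
  by_cases hr : IsRegularPoint3D Δ ℓ
  · exact pos3_of_forall_sector3Value_nonneg F D fun G hG₁ hG₂ =>
      sector3Value_nonneg_heavy F D hτ1 hτ0 hE1 hM hT (lt_of_le_of_ne hbd (Ne.symm hr.1)) hr.2 hΔ0 hG₁ hG₂
  · refine pos3_of_eventually_right F D hr ?_
    filter_upwards [eventually_isRegularPoint3D_nhdsGT_of_bound_le hbd, self_mem_nhdsWithin]
      with Δ' hΔ' hgt
    have hgt' : Δ < Δ' := Set.mem_Ioi.1 hgt
    exact ⟨hΔ', fun G hG₁ hG₂ => sector3Value_nonneg_heavy F D hτ1 hτ0 hE1 hM hT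
      (lt_of_le_of_lt hbd hgt') hΔ'.2 (hΔ0.trans hgt'.le) hG₁ hG₂⟩

/-- **Sector-`3` CELL RULE** (cell `[a, b]` strictly above the unitarity bound; `ℓ = 0` cells avoid
`Δ = 1`; `(Δt−Δφ)/2 ∈ [c₁, c₂]`; AB interval tables): a table `Φlo_q ≤ dom3Term(Δ + n, j)` on the cell, the
head number `oddHeadCellSumI ℓ c₁ c₂ a b S Φlo ≥ 0` and nonnegative dominated tail terms give `Pos3` at
every `Δ ∈ [a, b)`. [cite: DolanOsborn2004, §3 eq. (3.12)] [cite: KosPolandSimmonsduffin2014, §3.3 eq. (3.16), §4 eqs. (4.2)–(4.3)] -/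
theorem pos3_on_cell_Ico (F : ScanFunctional) (D : Dims) {ℓ : ℕ} {a b c₁ c₂ : ℝ}
    (ha : unitarityBound3D ℓ < a) (h1 : ℓ = 0 → 1 < a ∨ b ≤ 1) (hc1 : c₁ ≤ (D.Δt - D.Δφ) / 2)
    (hc2 : (D.Δt - D.Δφ) / 2 ≤ c₂) (S : Finset (ℕ × ℕ)) (Φlo : ℕ × ℕ → ℝ)
    (hΦ : ∀ q ∈ S, ∀ Δ ∈ Icc a b, Φlo q ≤ dom3Term F D (Δ + (q.1 : ℝ)) q.2)
    (hX : 0 ≤ oddHeadCellSumI ℓ c₁ c₂ a b S Φlo)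
    (htail : ∀ q : ℕ × ℕ, q ∉ S → InDescendantRange ℓ q.1 q.2 →
      ∀ E ∈ Icc (a + q.1) (b + q.1), 0 ≤ dom3Term F D E q.2) :
    ∀ Δ ∈ Ico a b, Pos3 F.toFunctional D Δ ℓ := by
  have h1' : ∀ Δ' ∈ Ico a b, ℓ = 0 → Δ' ≠ 1 := by
    intro Δ' hΔ' hℓ
    rcases h1 hℓ with h | h
    · exact ne_of_gt (by linarith [hΔ'.1])
    · exact ne_of_lt (by linarith [hΔ'.2])
  have hcell : ∀ Δ' ∈ Ico a b, IsRegularPoint3D Δ' ℓ → ∀ G : Label → ℝ → ℝ → ℝ,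
      IsConformalBlock3D (D.Δt - D.Δφ) (D.Δt - D.Δφ) Δ' ℓ (G .tφtφ) →
      IsConformalBlock3D (-(D.Δt - D.Δφ)) (D.Δt - D.Δφ) Δ' ℓ (G .φttφ) →
      0 ≤ sector3Value F D ((-1) ^ ℓ) G := by
    intro Δ' hΔ' hreg G hG₁ hG₂
    have hlt : unitarityBound3D ℓ < Δ' := lt_of_lt_of_le ha hΔ'.1
    have hΔI : Δ' ∈ Icc a b := ⟨hΔ'.1, hΔ'.2.le⟩
    exact (dom3Eval_nonneg_of_termwise F D hlt hreg.2 S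
        (headSumAB_nonneg_of_cellSumI (dom3Term F D) ha hΔI hc1 hc2 S Φlo (fun q hq => hΦ q hq Δ' hΔI) hX)
        (fun q hq hr => htail q hq hr (Δ' + (q.1 : ℝ)) ⟨by linarith [hΔI.1], by linarith [hΔI.2]⟩)
        hG₂).trans
      (dom3Eval_le_sector3Value F D (abs_neg_one_pow_le_one ℓ) hlt hreg.2 (h1' Δ' hΔ') hG₁ hG₂)
  intro Δ hΔ
  by_cases hr : IsRegularPoint3D Δ ℓ
  · exact pos3_of_forall_sector3Value_nonneg F D fun G hG₁ hG₂ => hcell Δ hΔ hr G hG₁ hG₂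
  · have hbd : unitarityBound3D ℓ ≤ Δ := ha.le.trans hΔ.1
    refine pos3_of_eventually_right F D hr ?_
    filter_upwards [eventually_isRegularPoint3D_nhdsGT_of_bound_le hbd, Ioo_mem_nhdsGT hΔ.2]
      with Δ' hΔ'reg hΔ'
    exact ⟨hΔ'reg, fun G hG₁ hG₂ => hcell Δ' ⟨hΔ.1.trans hΔ'.1.le, hΔ'.2⟩ hΔ'reg G hG₁ hG₂⟩

/-- **Sector-`3` cell rule with corner tables**: `Φlo_q = cornerBound₂ c₃ d₃ j (a+n) (b+n) Δt Δt`.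
[cite: DolanOsborn2004, §3 eq. (3.12)] [cite: HogervorstRychkov2013, §3 eq. (3.6)] -/
theorem pos3_on_cell_Ico_of_corners (F : ScanFunctional) (D : Dims) {ℓ : ℕ} {a b c₁ c₂ : ℝ}
    (ha : unitarityBound3D ℓ < a) (h1 : ℓ = 0 → 1 < a ∨ b ≤ 1) (hc1 : c₁ ≤ (D.Δt - D.Δφ) / 2)
    (hc2 : (D.Δt - D.Δφ) / 2 ≤ c₂) (S : Finset (ℕ × ℕ))
    (hX : 0 ≤ oddHeadCellSumI ℓ c₁ c₂ a b S (fun q => cornerBound₂ (cWeight3 F) (dWeight3 F) F.z F.zb q.2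
      (a + q.1) (b + q.1) (D.expo .φttφ) (D.expo .φttφ)))
    (htail : ∀ q : ℕ × ℕ, q ∉ S → InDescendantRange ℓ q.1 q.2 →
      ∀ E ∈ Icc (a + q.1) (b + q.1), 0 ≤ dom3Term F D E q.2) :
    ∀ Δ ∈ Ico a b, Pos3 F.toFunctional D Δ ℓ :=
  pos3_on_cell_Ico F D ha h1 hc1 hc2 S _ (fun q _ Δ hΔ =>
    cornerBound₂_le (cWeight3 F) (dWeight3 F) F.z F.zb F.hz F.hzb q.2 (E := Δ + (q.1 : ℝ))
      ⟨by linarith [hΔ.1], by linarith [hΔ.2]⟩ ⟨le_rfl, le_rfl⟩) hX htail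

/-- **Sector-`3` BOUND-CELL RULE with corner tables** (`ℓ ≥ 1`, cell `[a, b)` with `a ≥ ℓ + 1`, AB bound
tables): for the `spinning_3` rows of `O2Obligations` that start at the unitarity bound.
[cite: DolanOsborn2004, §3 eq. (3.11)] [cite: KosPolandSimmonsduffin2014, §3.3 eq. (3.16), §4 eqs. (4.2)–(4.3)] -/
theorem pos3_on_boundCell_Ico_of_corners (F : ScanFunctional) (D : Dims) {ℓ : ℕ} {a b c₁ c₂ : ℝ}
    (hℓ : 1 ≤ ℓ) (ha : (ℓ : ℝ) + 1 ≤ a) (hc1 : c₁ ≤ (D.Δt - D.Δφ) / 2) (hc2 : (D.Δt - D.Δφ) / 2 ≤ c₂)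
    (S : Finset (ℕ × ℕ))
    (hX : 0 ≤ oddHeadCellSumBd ℓ c₁ c₂ a b S (fun q => cornerBound₂ (cWeight3 F) (dWeight3 F) F.z F.zb q.2
      (a + q.1) (b + q.1) (D.expo .φttφ) (D.expo .φttφ)))
    (htail : ∀ q : ℕ × ℕ, q ∉ S → InDescendantRange ℓ q.1 q.2 →
      ∀ E ∈ Icc (a + q.1) (b + q.1), 0 ≤ dom3Term F D E q.2) :
    ∀ Δ ∈ Ico a b, Pos3 F.toFunctional D Δ ℓ := by
  have hcell : ∀ Δ' ∈ Icc a b, IsRegularPoint3D Δ' ℓ → ∀ G : Label → ℝ → ℝ → ℝ,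
      IsConformalBlock3D (D.Δt - D.Δφ) (D.Δt - D.Δφ) Δ' ℓ (G .tφtφ) →
      IsConformalBlock3D (-(D.Δt - D.Δφ)) (D.Δt - D.Δφ) Δ' ℓ (G .φttφ) →
      0 ≤ sector3Value F D ((-1) ^ ℓ) G := by
    intro Δ' hΔI hreg G hG₁ hG₂
    have hbd : unitarityBound3D ℓ ≤ Δ' := ((unitarityBound3D_le_add_one ℓ).trans ha).trans hΔI.1
    have hlt : unitarityBound3D ℓ < Δ' := lt_of_le_of_ne hbd (Ne.symm hreg.1)
    have hx : (ℓ : ℝ) + 1 < Δ' := by rw [← unitarityBound3D_of_one_le hℓ]; exact hlt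
    have hl0 : ℓ = 0 → Δ' ≠ 1 := fun h => absurd h (by omega)
    exact (dom3Eval_nonneg_of_termwise F D hlt hreg.2 S
        (headSumAB_nonneg_of_cellSumBd (dom3Term F D) hℓ ha hΔI hx hc1 hc2 S _ (fun q _ =>
          cornerBound₂_le (cWeight3 F) (dWeight3 F) F.z F.zb F.hz F.hzb q.2 (E := Δ' + (q.1 : ℝ))
            ⟨by linarith [hΔI.1], by linarith [hΔI.2]⟩ ⟨le_rfl, le_rfl⟩) hX)
        (fun q hq hr => htail q hq hr (Δ' + (q.1 : ℝ)) ⟨by linarith [hΔI.1], by linarith [hΔI.2]⟩)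
        hG₂).trans
      (dom3Eval_le_sector3Value F D (abs_neg_one_pow_le_one ℓ) hlt hreg.2 hl0 hG₁ hG₂)
  intro Δ hΔ
  by_cases hr : IsRegularPoint3D Δ ℓ
  · exact pos3_of_forall_sector3Value_nonneg F D fun G hG₁ hG₂ => hcell Δ ⟨hΔ.1, hΔ.2.le⟩ hr G hG₁ hG₂
  · have hbd : unitarityBound3D ℓ ≤ Δ := ((unitarityBound3D_le_add_one ℓ).trans ha).trans hΔ.1
    refine pos3_of_eventually_right F D hr ?_
    filter_upwards [eventually_isRegularPoint3D_nhdsGT_of_bound_le hbd, Ioo_mem_nhdsGT hΔ.2]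
      with Δ' hΔ'reg hΔ'
    exact ⟨hΔ'reg, fun G hG₁ hG₂ => hcell Δ' ⟨hΔ.1.trans hΔ'.1.le, hΔ'.2.le⟩ hΔ'reg G hG₁ hG₂⟩

/-! ### §3 Sector `2⁻` -/

/-- **Heavy range, sector `2⁻`, regular point** (`E₀ > 1`). [cite: PappadopuloRychkovEspinRattazzi2012, §5]
[cite: KosPolandSimmonsduffin2014, §3.3 eq. (3.16)] -/
theorem sector2mValue_nonneg_heavy (F : ScanFunctional) (D : Dims) {E₀ ET τ : ℝ} (hτ1 : τ ≤ 1)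
    (hτ0 : τ ≤ E₀) (hE1 : 1 < E₀)
    (hM : ∀ (j : ℕ) (E : ℝ), E₀ ≤ E → E < ET → (j : ℝ) + τ ≤ E → 0 ≤ dom2mTerm F D E j)
    (hT : ∀ E : ℝ, ET ≤ E → ∀ j : ℕ, (j : ℝ) ≤ E → 0 ≤ dom2mTerm F D E j)
    {Δ : ℝ} {ℓ : ℕ} (hΔ : unitarityBound3D ℓ < Δ) (hreg : ¬ accidentalDegeneracy3D Δ ℓ) (hΔ0 : E₀ ≤ Δ)
    {G : Label → ℝ → ℝ → ℝ} (hG₁ : IsConformalBlock3D (D.Δt - D.Δs) (D.Δt - D.Δs) Δ ℓ (G .tsts))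
    (hG₂ : IsConformalBlock3D (-(D.Δt - D.Δs)) (D.Δt - D.Δs) Δ ℓ (G .stts)) :
    0 ≤ sector2mValue F D G := by
  have h1 : ℓ = 0 → Δ ≠ 1 := fun _ => ne_of_gt (by linarith)
  exact (dom2mEval_nonneg_of_termwise F D hΔ hreg ∅ (by simp)
      (fun q _ hq => descendantTerms_nonneg_of_ranges (dom2mTerm F D) hτ1 hτ0 hM hT hΔ hΔ0 q hq) hG₂).trans
    (dom2mEval_le_sector2mValue F D hΔ hreg h1 hG₁ hG₂)

/-- **Heavy range, sector `2⁻`, all points** (the item `tail_2m` of `O2Obligations`, here for every spin;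
`E₀ > 1`). [cite: KosPolandSimmonsduffin2014, §3.3 eq. (3.16), §4 eqs. (4.2)–(4.3)] [cite: ChesterEtAl2020, §3.1 (functional conditions)] -/
theorem pos2m_heavy (F : ScanFunctional) (D : Dims) {E₀ ET τ : ℝ} (hτ1 : τ ≤ 1) (hτ0 : τ ≤ E₀)
    (hE1 : 1 < E₀)
    (hM : ∀ (j : ℕ) (E : ℝ), E₀ ≤ E → E < ET → (j : ℝ) + τ ≤ E → 0 ≤ dom2mTerm F D E j)
    (hT : ∀ E : ℝ, ET ≤ E → ∀ j : ℕ, (j : ℝ) ≤ E → 0 ≤ dom2mTerm F D E j) :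
    ∀ ℓ : ℕ, ∀ Δ : ℝ, unitarityBound3D ℓ ≤ Δ → E₀ ≤ Δ → Pos2m F.toFunctional D Δ ℓ := by
  intro ℓ Δ hbd hΔ0
  by_cases hr : IsRegularPoint3D Δ ℓ
  · exact pos2m_of_forall_sector2mValue_nonneg F D fun G hG₁ hG₂ =>
      sector2mValue_nonneg_heavy F D hτ1 hτ0 hE1 hM hT (lt_of_le_of_ne hbd (Ne.symm hr.1)) hr.2 hΔ0 hG₁ hG₂
  · refine pos2m_of_eventually_right F D hr ?_
    filter_upwards [eventually_isRegularPoint3D_nhdsGT_of_bound_le hbd, self_mem_nhdsWithin]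
      with Δ' hΔ' hgt
    have hgt' : Δ < Δ' := Set.mem_Ioi.1 hgt
    exact ⟨hΔ', fun G hG₁ hG₂ => sector2mValue_nonneg_heavy F D hτ1 hτ0 hE1 hM hT
      (lt_of_le_of_lt hbd hgt') hΔ'.2 (hΔ0.trans hgt'.le) hG₁ hG₂⟩

/-- **Sector-`2⁻` CELL RULE** (cell strictly above the bound; `ℓ = 0` cells avoid `Δ = 1` — vacuous for the
odd spins of `2⁻`; `(Δt−Δs)/2 ∈ [c₁, c₂]`). [cite: DolanOsborn2004, §3 eq. (3.12)]
[cite: KosPolandSimmonsduffin2014, §3.3 eq. (3.16), §4 eqs. (4.2)–(4.3)] -/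
theorem pos2m_on_cell_Ico (F : ScanFunctional) (D : Dims) {ℓ : ℕ} {a b c₁ c₂ : ℝ}
    (ha : unitarityBound3D ℓ < a) (h1 : ℓ = 0 → 1 < a ∨ b ≤ 1) (hc1 : c₁ ≤ (D.Δt - D.Δs) / 2)
    (hc2 : (D.Δt - D.Δs) / 2 ≤ c₂) (S : Finset (ℕ × ℕ)) (Φlo : ℕ × ℕ → ℝ)
    (hΦ : ∀ q ∈ S, ∀ Δ ∈ Icc a b, Φlo q ≤ dom2mTerm F D (Δ + (q.1 : ℝ)) q.2)
    (hX : 0 ≤ oddHeadCellSumI ℓ c₁ c₂ a b S Φlo)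
    (htail : ∀ q : ℕ × ℕ, q ∉ S → InDescendantRange ℓ q.1 q.2 →
      ∀ E ∈ Icc (a + q.1) (b + q.1), 0 ≤ dom2mTerm F D E q.2) :
    ∀ Δ ∈ Ico a b, Pos2m F.toFunctional D Δ ℓ := by
  have h1' : ∀ Δ' ∈ Ico a b, ℓ = 0 → Δ' ≠ 1 := by
    intro Δ' hΔ' hℓ
    rcases h1 hℓ with h | h
    · exact ne_of_gt (by linarith [hΔ'.1])
    · exact ne_of_lt (by linarith [hΔ'.2])
  have hcell : ∀ Δ' ∈ Ico a b, IsRegularPoint3D Δ' ℓ → ∀ G : Label → ℝ → ℝ → ℝ,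
      IsConformalBlock3D (D.Δt - D.Δs) (D.Δt - D.Δs) Δ' ℓ (G .tsts) →
      IsConformalBlock3D (-(D.Δt - D.Δs)) (D.Δt - D.Δs) Δ' ℓ (G .stts) →
      0 ≤ sector2mValue F D G := by
    intro Δ' hΔ' hreg G hG₁ hG₂
    have hlt : unitarityBound3D ℓ < Δ' := lt_of_lt_of_le ha hΔ'.1
    have hΔI : Δ' ∈ Icc a b := ⟨hΔ'.1, hΔ'.2.le⟩
    exact (dom2mEval_nonneg_of_termwise F D hlt hreg.2 S
        (headSumAB_nonneg_of_cellSumI (dom2mTerm F D) ha hΔI hc1 hc2 S Φlo (fun q hq => hΦ q hq Δ' hΔI) hX)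
        (fun q hq hr => htail q hq hr (Δ' + (q.1 : ℝ)) ⟨by linarith [hΔI.1], by linarith [hΔI.2]⟩)
        hG₂).trans
      (dom2mEval_le_sector2mValue F D hlt hreg.2 (h1' Δ' hΔ') hG₁ hG₂)
  intro Δ hΔ
  by_cases hr : IsRegularPoint3D Δ ℓ
  · exact pos2m_of_forall_sector2mValue_nonneg F D fun G hG₁ hG₂ => hcell Δ hΔ hr G hG₁ hG₂
  · have hbd : unitarityBound3D ℓ ≤ Δ := ha.le.trans hΔ.1
    refine pos2m_of_eventually_right F D hr ?_
    filter_upwards [eventually_isRegularPoint3D_nhdsGT_of_bound_le hbd, Ioo_mem_nhdsGT hΔ.2]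
      with Δ' hΔ'reg hΔ'
    exact ⟨hΔ'reg, fun G hG₁ hG₂ => hcell Δ' ⟨hΔ.1.trans hΔ'.1.le, hΔ'.2⟩ hΔ'reg G hG₁ hG₂⟩

/-- **Sector-`2⁻` cell rule with corner tables.** [cite: DolanOsborn2004, §3 eq. (3.12)] [cite: HogervorstRychkov2013, §3 eq. (3.6)] -/
theorem pos2m_on_cell_Ico_of_corners (F : ScanFunctional) (D : Dims) {ℓ : ℕ} {a b c₁ c₂ : ℝ}
    (ha : unitarityBound3D ℓ < a) (h1 : ℓ = 0 → 1 < a ∨ b ≤ 1) (hc1 : c₁ ≤ (D.Δt - D.Δs) / 2)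
    (hc2 : (D.Δt - D.Δs) / 2 ≤ c₂) (S : Finset (ℕ × ℕ))
    (hX : 0 ≤ oddHeadCellSumI ℓ c₁ c₂ a b S (fun q => cornerBound₂ (cWeight2m F) (dWeight2m F) F.z F.zb
      q.2 (a + q.1) (b + q.1) (D.expo .stts) (D.expo .stts)))
    (htail : ∀ q : ℕ × ℕ, q ∉ S → InDescendantRange ℓ q.1 q.2 →
      ∀ E ∈ Icc (a + q.1) (b + q.1), 0 ≤ dom2mTerm F D E q.2) :
    ∀ Δ ∈ Ico a b, Pos2m F.toFunctional D Δ ℓ :=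
  pos2m_on_cell_Ico F D ha h1 hc1 hc2 S _ (fun q _ Δ hΔ =>
    cornerBound₂_le (cWeight2m F) (dWeight2m F) F.z F.zb F.hz F.hzb q.2 (E := Δ + (q.1 : ℝ))
      ⟨by linarith [hΔ.1], by linarith [hΔ.2]⟩ ⟨le_rfl, le_rfl⟩) hX htail

/-- **Sector-`2⁻` BOUND-CELL RULE with corner tables** (`ℓ ≥ 1`, `a ≥ ℓ + 1`): for the `spinning_2m` rows of
`O2Obligations` that start at the unitarity bound. [cite: DolanOsborn2004, §3 eq. (3.11)]
[cite: KosPolandSimmonsduffin2014, §3.3 eq. (3.16), §4 eqs. (4.2)–(4.3)] -/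
theorem pos2m_on_boundCell_Ico_of_corners (F : ScanFunctional) (D : Dims) {ℓ : ℕ} {a b c₁ c₂ : ℝ}
    (hℓ : 1 ≤ ℓ) (ha : (ℓ : ℝ) + 1 ≤ a) (hc1 : c₁ ≤ (D.Δt - D.Δs) / 2) (hc2 : (D.Δt - D.Δs) / 2 ≤ c₂)
    (S : Finset (ℕ × ℕ))
    (hX : 0 ≤ oddHeadCellSumBd ℓ c₁ c₂ a b S (fun q => cornerBound₂ (cWeight2m F) (dWeight2m F) F.z F.zb
      q.2 (a + q.1) (b + q.1) (D.expo .stts) (D.expo .stts)))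
    (htail : ∀ q : ℕ × ℕ, q ∉ S → InDescendantRange ℓ q.1 q.2 →
      ∀ E ∈ Icc (a + q.1) (b + q.1), 0 ≤ dom2mTerm F D E q.2) :
    ∀ Δ ∈ Ico a b, Pos2m F.toFunctional D Δ ℓ := by
  have hcell : ∀ Δ' ∈ Icc a b, IsRegularPoint3D Δ' ℓ → ∀ G : Label → ℝ → ℝ → ℝ,
      IsConformalBlock3D (D.Δt - D.Δs) (D.Δt - D.Δs) Δ' ℓ (G .tsts) →
      IsConformalBlock3D (-(D.Δt - D.Δs)) (D.Δt - D.Δs) Δ' ℓ (G .stts) →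
      0 ≤ sector2mValue F D G := by
    intro Δ' hΔI hreg G hG₁ hG₂
    have hbd : unitarityBound3D ℓ ≤ Δ' := ((unitarityBound3D_le_add_one ℓ).trans ha).trans hΔI.1
    have hlt : unitarityBound3D ℓ < Δ' := lt_of_le_of_ne hbd (Ne.symm hreg.1)
    have hx : (ℓ : ℝ) + 1 < Δ' := by rw [← unitarityBound3D_of_one_le hℓ]; exact hlt
    have hl0 : ℓ = 0 → Δ' ≠ 1 := fun h => absurd h (by omega)
    exact (dom2mEval_nonneg_of_termwise F D hlt hreg.2 S
        (headSumAB_nonneg_of_cellSumBd (dom2mTerm F D) hℓ ha hΔI hx hc1 hc2 S _ (fun q _ =>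
          cornerBound₂_le (cWeight2m F) (dWeight2m F) F.z F.zb F.hz F.hzb q.2 (E := Δ' + (q.1 : ℝ))
            ⟨by linarith [hΔI.1], by linarith [hΔI.2]⟩ ⟨le_rfl, le_rfl⟩) hX)
        (fun q hq hr => htail q hq hr (Δ' + (q.1 : ℝ)) ⟨by linarith [hΔI.1], by linarith [hΔI.2]⟩)
        hG₂).trans
      (dom2mEval_le_sector2mValue F D hlt hreg.2 hl0 hG₁ hG₂)
  intro Δ hΔ
  by_cases hr : IsRegularPoint3D Δ ℓ
  · exact pos2m_of_forall_sector2mValue_nonneg F D fun G hG₁ hG₂ => hcell Δ ⟨hΔ.1, hΔ.2.le⟩ hr G hG₁ hG₂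
  · have hbd : unitarityBound3D ℓ ≤ Δ := ((unitarityBound3D_le_add_one ℓ).trans ha).trans hΔ.1
    refine pos2m_of_eventually_right F D hr ?_
    filter_upwards [eventually_isRegularPoint3D_nhdsGT_of_bound_le hbd, Ioo_mem_nhdsGT hΔ.2]
      with Δ' hΔ'reg hΔ'
    exact ⟨hΔ'reg, fun G hG₁ hG₂ => hcell Δ' ⟨hΔ.1.trans hΔ'.1.le, hΔ'.2.le⟩ hΔ'reg G hG₁ hG₂⟩

end Literature.MathematicalPhysics.QuantumFieldTheory.O2ChargedSectorsRules
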